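import Literature.MathematicalPhysics.QuantumFieldTheory.Balaban1983to89.B13Bound143OneShot

/-!
# NE9PencilScope238 — THE TYPED (R-0)[scope] CLAUSE of row NE9's TABLE half: «[II] Lemma 3 (2.38) read over Lemma 2's
# box» — for EVERY table with Lemma 2's listed properties (analytic on the space (1.34), (1.42), (1.43), (1.36), gauge
# invariant; NOT the representation equality (1.35)), at constants where the printed restrictions and `C₃ ≤ E₀C₁` are
# re-imposed, the activity built from that table obeys (2.38)

Cell `pub-balaban`, T4-DAG §6 NE9; BINDER row NE9 OWNER lineage `b2b-balaban-t4-ne9-p1` gen 61, CRUX PROVER NE9 (ruling e34b3e0c (2)).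
This is the owner's NAMED INTERFACE for the ONE displayed analytic input that BOTH co-lead routes' table halves consume (the
pencil `PotentialKPG W act m a d R₀` at every background incl. the vacuum: R4 `NE9HoloFamilyPotentialKPG` p258235, R3′
`NE9PencilEndSharpVacuum` p256132 ∕ `NE9VacuumSubtractedBridgeSharp` p256991), in the vocabulary of the Literature skeleton
`B13` (`StepData`, `Consts`, `Lemma2Printed`, `Lemma3Printed`, `Bound238`) — the item «NE9 typed (R-0) clause: not yet filed —
carried» of referee t4-ref2 (GAPS-T4 C-t4r2-483 (4) … pass 108), filed under the crux prover's INTERFACE REQUEST NE9 of this hour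
(HOME/INBOX.md).  A `def … : Prop` and two `rfl`-level junctions; NOTHING is asserted.

CLASS WORDS (ABSOLUTE RULE).  (R-0) «STATEMENT SCOPE» — NOT PRINTED AS STATED.  Print's literal quantifier is THE table: [II] =
[Balaban1988RG2Cluster] p. 20 l. 34–36 *"Lemma 3. Under all the above restrictions on the constants M, κ, κ₁, α₀, α₁, α₄, α₆, γ₂, γ,
ε₁, the activity H(Z) for a localization domain Z ∈ D_{k+1} satisfies … (2.38)"* — hypothesis = CONSTANTS ONLY, subject = the
activity built by (2.9)–(2.14) from THE table V_k of Lemma 2 (p. 11 l. 14–26).  The READING typed here — that the printed proof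
pp. 12–20 uses the table ONLY through analyticity on (1.34), the split (1.42), the bounds (1.43) and (1.36), and gauge invariance,
at complex multiples τ(Y) (p. 15 l. 19–25; p. 16 l. 12–13 *"The expression in the last exponential can be estimated using (1.42),
and the inequalities (1.43), (1.36)"* + the radii (2.18) and *"C₃ ≤ E₀C₁, q ≥ 8"*; p. 19 l. 2–4 ε₂; p. 21 l. 17–18; p. 21 l. 33–36 the
only use of Lemma 2 beyond its bounds = identification), hence holds for ANY such table — is the cell's ruling of record: refuter
PRICING-NE9 v2 §B (C-ne9ref-g2-1: «literal (i), proof (ii), class (R-0); (1.35) NOT preserved along the pencil but UNUSED in the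
bound ⇒ the typed scope clause must list Lemma 2's properties MINUS (1.35)»; owner record §65.9–65.10, GAPS G-ne9p1-58-1) COUNTERSIGNED
by referee t4-ref2 C-t4r2-480 with the NARROWING this file carries: **(a)** the varied table KEEPS ANALYTICITY ON THE SPACE (1.34) =
`U^c_{k+1}(X, α₀, α₁)` as a HYPOTHESIS (p. 15 l. 19–25 uses the space's `U′Ũ` structure and the positivity of the measure at (U, 0) — a
property of the SPACE; it is the first conjunct of `B13.Lemma2Printed`, displayed, not assumed); **(b)** every printed restriction is
RE-IMPOSED AT THE CONSTANTS AT WHICH THE CLAUSE IS INVOKED (the instancer's inflated constants `C₃ ↦ (1+2|θ|)C₃`, `E₀ ↦ (1+2|θ|)E₀`,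
`ε₁ ↦ ε₁∕(1+2R₀)`) and the ratio restriction `C₃ ≤ E₀C₁` is CHECKED THERE (`B13Bound143.R12`, p. 16).  (1.35) is NOT a
hypothesis: `B13.Lemma2Printed` types «analyticity ∧ (1.42) ∧ (1.43) ∧ (1.36) ∧ gauge invariance» and carries (1.33)∕(1.35) in the
carrier, so `Lemma2Printed` of the varied data IS «Lemma 2's listed properties except (1.35)».  The construction «table ↦ activity»
((2.9)–(2.14); `B13Term214.display214` types one term) is DATA of the clause (`HOf`), supplied by the model O-NE9-1 (wall W1) — nothing
about it is assumed here.  With `HOf S.V = S.H` and `RestrAt c ↔ S.Restr` the clause at the printed table and constants gives back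
`B13.Lemma3Printed S c` under `R12 c` (§2) — it EXTENDS print's typed statement, it does not assert it.

HONEST FRAMING (T4-DAG PAGE 1).  Rung (B)+1 of the FINITE-VOLUME T⁴ programme — NOT infinite volume, NOT a mass gap, NOT Clay.  NE9
(`T4OutputRate.NE9` ∧ `FadingMemory`) is a cell NEW ESTIMATE, NOT PRINTED, NOT PROVED («NE9 ⇐ the named binders»); this file moves
no count: it NAMES a displayed input (class (R-0) + T((2.38) literal)); W1 = model O-NE9-1, the coupling two-point and the displays are
untouched; spine PROVED 0∕9.  HONEST DEPENDENCY (cell line, verbatim): continuum YM on T⁴ ⇐ BetaPertH ∧ nine spine estimates (0/9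
proved); BetaPertH ⇐ (D1) ∧ (D4) ∧ CAP+tail; G-an2-4 gates asym, D1 and NE2/3/4.  `FlowStep.BetaPertH`, (B), (B^μ) do not occur.
[Balaban1988RG2Cluster] is a manuscript UNDER ADJUDICATION by the cell: its Lemmas 2–3 are TYPED (`B13`), never asserted; this file
asserts nothing of them either (DISGUISE TEST: a `Prop`-valued definition quantified over tables and constants + two definitional
unfoldings).  References: T. Bałaban, *Renormalization group approach to lattice gauge field theories. II. Cluster expansions*,
Commun. Math. Phys. **116** (1988) 1–22 [Balaban1988RG2Cluster] — Lemma 2 p. 11, (1.34)–(1.36) p. 9, (1.42)–(1.43) p. 11, (2.14)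
p. 15, p. 16 (after (2.18)), Lemma 3 (2.38) p. 20, p. 21.  Summits-side NEW work (LEAN PLACEMENT RULE); imports `B13Bound143OneShot`
(→ `B13`) only; modifies nothing; 0 sorry.  Value = the instancer's (R-0) checklist line as ONE Lean name, NOT summit progress.
-/

namespace Summit.QuantumFields.BalabanUV.T4Continuum.NE9PencilScope238

open Literature.MathematicalPhysics.QuantumFieldTheory.Balaban1983to89

/-! ## §1 The varied step data and the clause -/

/-- DATA: the step data `S` of [II] with THE table triple of Lemma 2 — `V` (1.41), the operator `Q` of the quadratic form and
`V″` of (1.42) — REPLACED by another triple `(V′, Q′, V″′)` on the same carriers and spaces, the activity replaced by the one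
BUILT FROM `V′` by the construction «table ↦ activity» `HOf` ((2.9)–(2.14): Mayer expansion, decoupling, (2.14); a DATUM — the
model O-NE9-1 supplies it), and Lemma 3's restriction clause replaced by `R` (the restrictions re-imposed at the constants of use).
Everything else (domains, spaces (1.34) `sp1` ∕ `sp2`, the analyticity and gauge-invariance predicates, `E^{(k+1)}`) is `S`'s.
[cite: Balaban1988RG2Cluster, Lemma 2 p.11 and (2.14) p.15] -/
def withTable (S : B13.StepData) (HOf : (S.Dk.Dom → S.Φ → ℂ) → S.Dk1.Dom → S.Φ → ℂ) (V' : S.Dk.Dom → S.Φ → ℂ)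
    (Q' : S.Dk.Dom → S.Φ → S.Bond → S.Bond → ℂ) (Vpp' : S.Dk.Dom → S.Φ → ℂ) (R : Prop) : B13.StepData :=
  { S with V := V', Q := Q', Vpp := Vpp', H := HOf V', Restr := R }

/-- **THE TYPED (R-0)[scope] CLAUSE «[II] Lemma 3 (2.38) READ OVER LEMMA 2's BOX»** (class (R-0) statement scope — NOT PRINTED as
stated; cell ruling C-ne9ref-g2-1 countersigned C-t4r2-480 with narrowing (a)(b)).  For the step data `S`, a construction «table ↦
activity» `HOf` and a restriction schedule `RestrAt : Consts → Prop` («all the above restrictions on the constants … » of Lemma 3,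
RE-IMPOSED at the constants `c′` at which the clause is used — clause (b)): FOR EVERY constants record `c′` and EVERY table triple
`(V′, Q′, V″′)` that has Lemma 2's LISTED properties at `c′` — analytic on the space (1.34) (clause (a): the first conjunct of
`Lemma2Printed`), the split (1.42), the bound (1.43) for `Q′`, the bound (1.36) for `V″′`, gauge invariance of the three functions;
NOT the representation equality (1.35) — and for which the p. 16 restriction `R12 c′` (incl. `C₃ ≤ E₀C₁`) holds, Lemma 3's typed
statement holds for the activity `HOf V′`: `RestrAt c′ → |HOf V′ (Z)| ≤ C₃(c′)ε₁(c′)·exp(−(1−8δ)½Lκ d_{k+1}(Z))` on the space (2.38)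
is stated on.  At a pencil `V′ = V_k + θ(V − V_k)` inside the (1.36)-weighted ball of radius `R₀` the instancer takes `c′ =` the
inflated constants.  Displayed by BOTH co-lead routes' table halves as their ONE analytic input (`PotentialKPG` at every background);
discharged by NOBODY (it is a reading of print's proof scope). [cite: Balaban1988RG2Cluster, Lemma 3 (2.38) p.20, Lemma 2 p.11, p.15-16, p.21] -/
def PencilScope238 (S : B13.StepData) (HOf : (S.Dk.Dom → S.Φ → ℂ) → S.Dk1.Dom → S.Φ → ℂ) (RestrAt : B13.Consts → Prop) : Prop :=
  ∀ (c' : B13.Consts) (V' : S.Dk.Dom → S.Φ → ℂ) (Q' : S.Dk.Dom → S.Φ → S.Bond → S.Bond → ℂ) (Vpp' : S.Dk.Dom → S.Φ → ℂ),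
    B13.Lemma2Printed (withTable S HOf V' Q' Vpp' (RestrAt c')) c' → B13Bound143.R12 c' →
      B13.Lemma3Printed (withTable S HOf V' Q' Vpp' (RestrAt c')) c'

/-! ## §2 Two definitional junctions (nothing asserted) -/

/-- [folklore] WHAT THE CLAUSE CONCLUDES, UNFOLDED: Lemma 3's typed statement for the varied data is «the re-imposed restrictions
imply (2.38) for the activity built from `V′`, on the space `sp2`» — by `Iff.rfl`. [cite: Balaban1988RG2Cluster, Lemma 3 (2.38) p.20] -/
theorem lemma3Printed_withTable_iff (S : B13.StepData) (HOf : (S.Dk.Dom → S.Φ → ℂ) → S.Dk1.Dom → S.Φ → ℂ)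
    (V' : S.Dk.Dom → S.Φ → ℂ) (Q' : S.Dk.Dom → S.Φ → S.Bond → S.Bond → ℂ) (Vpp' : S.Dk.Dom → S.Φ → ℂ) (R : Prop)
    (c : B13.Consts) :
    B13.Lemma3Printed (withTable S HOf V' Q' Vpp' R) c ↔
      (R → ∀ Z φ, φ ∈ S.sp2 Z → ‖HOf V' Z φ‖ ≤
        c.C3act * c.ε₁ * Real.exp (-((1 - 8 * c.δ) * ((c.L : ℝ) / 2) * c.κ * S.Dk1.dj Z))) :=
  Iff.rfl

/-- [folklore] **AT THE PRINTED TABLE THE CLAUSE IS LEMMA 3's TYPED STATEMENT** (the clause EXTENDS print, it does not assert it):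
if the construction returns the printed activity at the printed table (`HOf S.V = S.H`) and the schedule at `c` is print's
restriction clause (`RestrAt c ↔ S.Restr`), then `PencilScope238` at `(c, V_k, Q, V″_k)` gives `Lemma2Printed S c → R12 c →
Lemma3Printed S c`. [cite: Balaban1988RG2Cluster, Lemma 2 p.11 and Lemma 3 p.20] -/
theorem lemma3Printed_of_pencilScope_self (S : B13.StepData) {HOf : (S.Dk.Dom → S.Φ → ℂ) → S.Dk1.Dom → S.Φ → ℂ}
    {RestrAt : B13.Consts → Prop} (h : PencilScope238 S HOf RestrAt) {c : B13.Consts} (hH : HOf S.V = S.H)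
    (hR : RestrAt c ↔ S.Restr) (h2 : B13.Lemma2Printed S c) (h12 : B13Bound143.R12 c) : B13.Lemma3Printed S c := by
  intro hRestr Z φ hφ
  have h3 := h c S.V S.Q S.Vpp h2 h12 (hR.mpr hRestr) Z φ hφ
  simpa only [withTable, hH] using h3

end Summit.QuantumFields.BalabanUV.T4Continuum.NE9PencilScope238
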